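import Mathlib.NumberTheory.AbelSummation
import Mathlib.MeasureTheory.Integral.IntervalIntegral.IntegrationByParts
import Mathlib.Analysis.SpecialFunctions.Log.Deriv
import Mathlib.Analysis.SpecialFunctions.Integrals.Basic
import Mathlib.NumberTheory.PrimeCounting
import HarnessLib

/-!
# Weighted Mertens sums by Abel summation (towards Irving 2015, Lemma 4.2)

Seventh proved layer under the named fact `Irving2015_largestPrimeFactor_cubic`
(`LargestPrimeFactorCubic.lean`; A. J. Irving, arXiv:1412.0024 = Acta Arith. 171 (2015)).
Irving's second estimate for `T(h,δ)` (Lemma 4.2, §4) tilts the `k`-fold prime sums of §3 by the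
weight `exp(α(s₁ + … + s_k))`, `s_i = log p_i/log X`, and evaluates
`∑_{X^δ ≤ p ≤ X^b} ν(p) p^{-1} p^{α/log X} → ∫_δ^b e^{αs} ds/s` "by partial summation".  This file
proves the general partial-summation inequality behind that step, for arbitrary nonnegative
prime weights with a two-sided Mertens estimate and an arbitrary nondecreasing `C¹` weight:

* `Irving2015.sum_mul_le_integral_add` — if `|∑_{p ≤ t} a_p − log log t − c| ≤ C/log² t`
  (`t ≥ 2`), `g ≥ 0` with continuous `g' ≥ 0` on `[y, x]`, `2 ≤ y ≤ x`, then
  `∑_{y < p ≤ x} a_p g(p) ≤ ∫_y^x g(t) dt/(t log t) + 4C g(x)/log² y`.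

Proof: Abel summation (Mathlib's `sum_mul_eq_sub_sub_integral_mul`) against
`M(t) − M(y)`, `M(t) = ∑_{p ≤ t} a_p`; the bounds `log log t − log log y − 2C/log² y ≤ M(t) − M(y)`,
`M(x) − M(y) ≤ log log x − log log y + 2C/log² y`; and the integration by parts
`g(x) m(x) − ∫_y^x g' m = ∫_y^x g m'` for `m(t) = log log t − log log y`, `m' = 1/(t log t)`
(Mathlib's `intervalIntegral.integral_mul_deriv_eq_deriv_mul`).  Everything is PROVED; no
number-theoretic input is used here (the Mertens estimate is a hypothesis, supplied for
`a_p = ν(p)/p` by `Irving2015.exists_sum_rootCount_div_eq` of `LargestPrimeFactorCubicTBound.lean`).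

## References

* A. J. Irving, *The largest prime factor of `X³ + 2`*, arXiv:1412.0024; Acta Arith. 171 (2015)
  67–80, §3 ("we may repeatedly apply partial integration and summation") and §4, Lemma 4.2.
  [`Irving2014LargestPrimeFactorCubic`]
* G. H. Hardy, E. M. Wright, *An Introduction to the Theory of Numbers*, 6th ed., §22.7 (partial
  summation for Mertens' theorems). [`HardyWright2008`]
-/

noncomputable section

open Finset Real Filter MeasureTheory intervalIntegral

namespace Literature.NumberTheory.Sieve

namespace Irving2015

/-- The prime sum `t ↦ ∑_{p ≤ t} a_p` is a measurable step function (private copy of the tree's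
`FriedlanderIwaniecPrimesHyp27.measurable_primeSum`, kept local to keep this file's imports
Mathlib-only). [folklore] -/
private theorem measurable_sum_primesLE (a : ℕ → ℝ) :
    Measurable (fun t : ℝ => ∑ p ∈ Nat.primesLE ⌊t⌋₊, a p) := by
  have : (fun t : ℝ => ∑ p ∈ Nat.primesLE ⌊t⌋₊, a p) =
      (fun n : ℕ => ∑ p ∈ Nat.primesLE n, a p) ∘ Nat.floor := by funext t; rfl
  rw [this]
  exact (measurable_from_nat (f := fun n : ℕ => ∑ p ∈ Nat.primesLE n, a p)).comp
    Nat.measurable_floor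

/-- **Weighted Mertens sums by Abel summation.**  Let `a_p ≥ 0` be weights on the primes whose
Mertens sums satisfy `|∑_{p ≤ t} a_p − log log t − c| ≤ C/log² t` (`t ≥ 2`), and let `g ≥ 0` be
differentiable with continuous derivative `g' ≥ 0` on `[y, x]`, `2 ≤ y ≤ x`.  Then
`∑_{y < p ≤ x} a_p g(p) ≤ ∫_y^x g(t) dt/(t log t) + 4C g(x)/log² y`
(Abel summation against `M(t) − M(y)`, the two-sided Mertens bound, and an integration by parts
for the main term `log log t − log log y`).  With `g(t) = t^{α/log X}` and `a_p = ν(p)/p` this is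
the step "`∑ ν(p) p^{-1} e^{α s_p} → ∫ e^{αs} ds/s`" of Irving's Lemma 4.2. [folklore] -/
theorem sum_mul_le_integral_add {a : ℕ → ℝ} (ha : ∀ p, 0 ≤ a p) {c C : ℝ}
    (hM : ∀ t : ℝ, 2 ≤ t →
      |∑ p ∈ Nat.primesLE ⌊t⌋₊, a p - (Real.log (Real.log t) + c)| ≤ C / Real.log t ^ 2)
    {g g' : ℝ → ℝ} {y x : ℝ} (hy : 2 ≤ y) (hyx : y ≤ x)
    (hg : ∀ t ∈ Set.Icc y x, HasDerivAt g (g' t) t) (hg'c : ContinuousOn g' (Set.Icc y x))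
    (hg'0 : ∀ t ∈ Set.Icc y x, 0 ≤ g' t) (hg0 : ∀ t ∈ Set.Icc y x, 0 ≤ g t) :
    ∑ p ∈ (Nat.primesLE ⌊x⌋₊).filter (fun p : ℕ => y < (p : ℝ)), a p * g p ≤
      (∫ t in y..x, g t / (t * Real.log t)) + 4 * C / Real.log y ^ 2 * g x := by
  have hy0 : 0 ≤ y := by linarith
  have hx2 : 2 ≤ x := hy.trans hyx
  set M : ℝ → ℝ := fun t => ∑ p ∈ Nat.primesLE ⌊t⌋₊, a p with hMdef
  -- Abel summation with `c k = a k 1_{k prime}`, `f = g`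
  set w : ℕ → ℝ := fun k => if k.Prime then a k else 0 with hw
  have hS : ∀ t : ℝ, ∑ k ∈ Icc 0 ⌊t⌋₊, w k = M t := by
    intro t
    rw [hMdef]; simp only
    rw [Nat.primesLE, Nat.primesBelow, Finset.sum_filter, Finset.range_eq_Ico,
      ← Finset.Ico_succ_right_eq_Icc]
    rfl
  have hf_diff : ∀ t ∈ Set.Icc y x, DifferentiableAt ℝ g t := fun t ht => (hg t ht).differentiableAt
  have hderiv_eq : Set.EqOn g' (deriv g) (Set.Icc y x) := fun t ht => ((hg t ht).deriv).symm
  have hg'int : IntegrableOn g' (Set.Icc y x) := hg'c.integrableOn_Icc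
  have hf_int : IntegrableOn (deriv g) (Set.Icc y x) := hg'int.congr_fun hderiv_eq measurableSet_Icc
  have habel := sum_mul_eq_sub_sub_integral_mul w hy0 hyx hf_diff hf_int
  -- identify the left side
  have hlhs : ∑ k ∈ Ioc ⌊y⌋₊ ⌊x⌋₊, g k * w k =
      ∑ p ∈ (Nat.primesLE ⌊x⌋₊).filter (fun p : ℕ => y < (p : ℝ)), a p * g p := by
    have hset : (Ioc ⌊y⌋₊ ⌊x⌋₊).filter Nat.Prime =
        (Nat.primesLE ⌊x⌋₊).filter (fun p : ℕ => y < (p : ℝ)) := by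
      ext p
      simp only [Finset.mem_filter, Finset.mem_Ioc, Nat.mem_primesLE]
      constructor
      · rintro ⟨⟨h1, h2⟩, hp⟩
        exact ⟨⟨h2, hp⟩, (Nat.floor_lt hy0).1 h1⟩
      · rintro ⟨⟨h2, hp⟩, h1⟩
        exact ⟨⟨(Nat.floor_lt hy0).2 h1, h2⟩, hp⟩
    calc ∑ k ∈ Ioc ⌊y⌋₊ ⌊x⌋₊, g k * w k
        = ∑ k ∈ Ioc ⌊y⌋₊ ⌊x⌋₊, (if k.Prime then a k * g k else 0) := by
          refine Finset.sum_congr rfl (fun k _ => ?_)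
          simp only [hw]
          split_ifs <;> ring
      _ = ∑ k ∈ (Ioc ⌊y⌋₊ ⌊x⌋₊).filter Nat.Prime, a k * g k := (Finset.sum_filter _ _).symm
      _ = _ := by rw [hset]
  rw [hlhs, hS, hS] at habel
  have hint_eq : ∫ t in Set.Ioc y x, deriv g t * ∑ k ∈ Icc 0 ⌊t⌋₊, w k =
      ∫ t in Set.Ioc y x, g' t * M t := by
    refine setIntegral_congr_fun measurableSet_Ioc fun t ht => ?_
    rw [← hderiv_eq (Set.Ioc_subset_Icc_self ht), hS]
  rw [hint_eq] at habel
  -- the Mertens information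
  have hlogy : 0 < Real.log y := Real.log_pos (by linarith)
  have hC0 : 0 ≤ C := by
    have := (abs_nonneg _).trans (hM y hy)
    by_contra hneg
    have : C / Real.log y ^ 2 < 0 := div_neg_of_neg_of_pos (lt_of_not_ge hneg) (by positivity)
    linarith
  set e : ℝ := 2 * C / Real.log y ^ 2 with he
  have he0 : 0 ≤ e := by rw [he]; positivity
  set m : ℝ → ℝ := fun t => Real.log (Real.log t) - Real.log (Real.log y) with hm
  have hDlow : ∀ t ∈ Set.Icc y x, m t - e ≤ M t - M y := by
    intro t ht
    have ht2 : 2 ≤ t := hy.trans ht.1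
    have h1 := (abs_le.1 (hM t ht2)).1
    have h2 := (abs_le.1 (hM y hy)).2
    have hlogt : Real.log y ≤ Real.log t := Real.log_le_log (by linarith) ht.1
    have hCt : C / Real.log t ^ 2 ≤ C / Real.log y ^ 2 :=
      div_le_div_of_nonneg_left hC0 (by positivity) (pow_le_pow_left₀ hlogy.le hlogt 2)
    rw [hm, he]; simp only
    have : 2 * C / Real.log y ^ 2 = C / Real.log y ^ 2 + C / Real.log y ^ 2 := by ring
    linarith
  have hDx : M x - M y ≤ m x + e := by
    have h1 := (abs_le.1 (hM x hx2)).2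
    have h2 := (abs_le.1 (hM y hy)).1
    have hlogx : Real.log y ≤ Real.log x := Real.log_le_log (by linarith) hyx
    have hCx : C / Real.log x ^ 2 ≤ C / Real.log y ^ 2 :=
      div_le_div_of_nonneg_left hC0 (by positivity) (pow_le_pow_left₀ hlogy.le hlogx 2)
    rw [hm, he]; simp only
    have : 2 * C / Real.log y ^ 2 = C / Real.log y ^ 2 + C / Real.log y ^ 2 := by ring
    linarith
  -- integrability facts on `[y, x]`
  have hMmeas : Measurable M := measurable_sum_primesLE a
  have hMbdd : ∀ t ∈ Set.Icc y x, |M t - M y| ≤ M x + M y := by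
    intro t ht
    have hMt : 0 ≤ M t := Finset.sum_nonneg (fun p _ => ha p)
    have hMy : 0 ≤ M y := Finset.sum_nonneg (fun p _ => ha p)
    have hMtx : M t ≤ M x := by
      refine Finset.sum_le_sum_of_subset_of_nonneg (fun p hp => ?_) (fun p _ _ => ha p)
      rw [Nat.mem_primesLE] at hp ⊢
      exact ⟨hp.1.trans (Nat.floor_le_floor ht.2), hp.2⟩
    rw [abs_le]; constructor <;> linarith
  have hmderiv : ∀ t ∈ Set.Icc y x, HasDerivAt m (1 / (t * Real.log t)) t := by
    intro t ht
    have ht0 : 0 < t := by linarith [ht.1]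
    have hlt : 0 < Real.log t := Real.log_pos (by linarith [ht.1])
    have h1 : HasDerivAt (fun s => Real.log (Real.log s)) (t⁻¹ / Real.log t) t :=
      (Real.hasDerivAt_log ht0.ne').log hlt.ne'
    have h2 := h1.sub_const (Real.log (Real.log y))
    have h3 : HasDerivAt m (t⁻¹ / Real.log t) t := by rw [hm]; exact h2
    exact h3.congr_deriv (by rw [div_eq_mul_inv, one_div, mul_inv])
  have hmcont : ContinuousOn m (Set.Icc y x) :=
    fun t ht => (hmderiv t ht).continuousAt.continuousWithinAt
  have hm'cont : ContinuousOn (fun t => 1 / (t * Real.log t)) (Set.Icc y x) := by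
    refine ContinuousOn.div continuousOn_const (continuousOn_id.mul
      (Real.continuousOn_log.mono fun t ht => ?_)) fun t ht => ?_
    · exact (show (0 : ℝ) < t by linarith [ht.1]).ne'
    · have : (0 : ℝ) < t := by linarith [ht.1]
      exact mul_ne_zero this.ne' (Real.log_pos (by linarith [ht.1])).ne'
  have hgcont : ContinuousOn g (Set.Icc y x) :=
    fun t ht => (hg t ht).continuousAt.continuousWithinAt
  -- `∫ g' (M − M y) ≥ ∫ g' (m − e)`
  have hI1 : IntegrableOn (fun t => g' t * (M t - M y)) (Set.Ioc y x) := by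
    refine Integrable.mono' (g := fun t => |g' t| * (M x + M y)) ?_ ?_ ?_
    · exact ((hg'c.abs.mul continuousOn_const).integrableOn_Icc).mono_set Set.Ioc_subset_Icc_self
    · exact ((hg'c.mono Set.Ioc_subset_Icc_self).aestronglyMeasurable measurableSet_Ioc).mul
        ((hMmeas.sub measurable_const).aestronglyMeasurable)
    · refine (ae_restrict_iff' measurableSet_Ioc).2 (Filter.Eventually.of_forall fun t ht => ?_)
      rw [norm_mul, Real.norm_eq_abs, Real.norm_eq_abs]
      exact mul_le_mul_of_nonneg_left (hMbdd t (Set.Ioc_subset_Icc_self ht)) (abs_nonneg _)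
  have hI2 : IntegrableOn (fun t => g' t * (m t - e)) (Set.Ioc y x) :=
    ((hg'c.mul (hmcont.sub continuousOn_const)).integrableOn_Icc).mono_set Set.Ioc_subset_Icc_self
  have hmono : ∫ t in Set.Ioc y x, g' t * (m t - e) ≤ ∫ t in Set.Ioc y x, g' t * (M t - M y) := by
    refine setIntegral_mono_on hI2 hI1 measurableSet_Ioc fun t ht => ?_
    exact mul_le_mul_of_nonneg_left (hDlow t (Set.Ioc_subset_Icc_self ht))
      (hg'0 t (Set.Ioc_subset_Icc_self ht))
  -- rewrite `∫ g' M = M(y) (g x − g y) + ∫ g' (M − M y)`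
  have hgint : ∫ t in Set.Ioc y x, g' t = g x - g y := by
    rw [← integral_of_le hyx]
    exact integral_eq_sub_of_hasDerivAt (fun t ht => by
      rw [Set.uIcc_of_le hyx] at ht; exact hg t ht)
      ((hg'c.mono (by rw [Set.uIcc_of_le hyx])).intervalIntegrable)
  have hsplitM : ∫ t in Set.Ioc y x, g' t * M t =
      M y * (g x - g y) + ∫ t in Set.Ioc y x, g' t * (M t - M y) := by
    have : (fun t => g' t * M t) = fun t => M y * g' t + g' t * (M t - M y) := by
      funext t; ring
    rw [this, MeasureTheory.integral_add, MeasureTheory.integral_const_mul, hgint]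
    · exact (hg'int.mono_set Set.Ioc_subset_Icc_self).const_mul _
    · exact hI1
  -- integration by parts for the main term: `g x · m x − ∫ g' m = ∫ g m'`
  have hparts : ∫ t in Set.Ioc y x, g' t * m t =
      g x * m x - ∫ t in y..x, g t / (t * Real.log t) := by
    rw [← integral_of_le hyx]
    have hu : ∀ t ∈ Set.uIcc y x, HasDerivAt m (1 / (t * Real.log t)) t := fun t ht => by
      rw [Set.uIcc_of_le hyx] at ht; exact hmderiv t ht
    have hv : ∀ t ∈ Set.uIcc y x, HasDerivAt g (g' t) t := fun t ht => by
      rw [Set.uIcc_of_le hyx] at ht; exact hg t ht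
    have hu' : IntervalIntegrable (fun t => 1 / (t * Real.log t)) volume y x :=
      (hm'cont.mono (by rw [Set.uIcc_of_le hyx])).intervalIntegrable
    have hv' : IntervalIntegrable g' volume y x :=
      (hg'c.mono (by rw [Set.uIcc_of_le hyx])).intervalIntegrable
    have h := integral_mul_deriv_eq_deriv_mul hu hv hu' hv'
    -- `h : ∫ m g' = m x g x − m y g y − ∫ m' g`
    have hmy : m y = 0 := by rw [hm]; simp
    have e1 : ∫ t in y..x, g' t * m t = ∫ t in y..x, m t * g' t :=
      integral_congr fun t _ => by ring
    have e2 : ∫ t in y..x, g t / (t * Real.log t) = ∫ t in y..x, 1 / (t * Real.log t) * g t :=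
      integral_congr fun t _ => by ring
    rw [e1, h, hmy, e2]; ring
  -- `∫ g' (m − e) = ∫ g' m − e (g x − g y)`
  have hsplitm : ∫ t in Set.Ioc y x, g' t * (m t - e) =
      (∫ t in Set.Ioc y x, g' t * m t) - e * (g x - g y) := by
    have : (fun t => g' t * (m t - e)) = fun t => g' t * m t - e * g' t := by funext t; ring
    rw [this, MeasureTheory.integral_sub, MeasureTheory.integral_const_mul, hgint]
    · exact ((hg'c.mul hmcont).integrableOn_Icc).mono_set Set.Ioc_subset_Icc_self
    · exact (hg'int.mono_set Set.Ioc_subset_Icc_self).const_mul _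
  -- combine
  have hgx : 0 ≤ g x := hg0 x ⟨hyx, le_rfl⟩
  have hgy : 0 ≤ g y := hg0 y ⟨le_rfl, hyx⟩
  have hgxy : g y ≤ g x := by
    have := hgint ▸ setIntegral_nonneg measurableSet_Ioc (fun t ht => hg'0 t (Set.Ioc_subset_Icc_self ht))
    linarith
  rw [habel, hsplitM]
  have key : g x * M x - g y * M y - (M y * (g x - g y) + ∫ t in Set.Ioc y x, g' t * (M t - M y)) =
      g x * (M x - M y) - ∫ t in Set.Ioc y x, g' t * (M t - M y) := by ring
  rw [key]
  have h1 : g x * (M x - M y) ≤ g x * (m x + e) := mul_le_mul_of_nonneg_left hDx hgx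
  have h2 : -(∫ t in Set.Ioc y x, g' t * (M t - M y)) ≤ -(∫ t in Set.Ioc y x, g' t * (m t - e)) :=
    neg_le_neg hmono
  rw [hsplitm, hparts] at h2
  have h4e : 4 * C / Real.log y ^ 2 = 2 * e := by rw [he]; ring
  rw [h4e]
  nlinarith [h1, h2, hgx, hgy, hgxy, he0]

/-- Change of variables `u = log t`: `∫_y^x t^θ dt/(t log t) = ∫_{log y}^{log x} e^{θu} du/u`
(`1 < y ≤ x`). [folklore] -/
theorem integral_rpow_div_mul_log_eq {y x : ℝ} (hy : 1 < y) (hyx : y ≤ x) (θ : ℝ) :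
    ∫ t in y..x, t ^ θ / (t * Real.log t) =
      ∫ u in Real.log y..Real.log x, Real.exp (θ * u) / u := by
  have hmem : ∀ t ∈ Set.uIcc y x, 0 < t := fun t ht => by
    rw [Set.uIcc_of_le hyx] at ht; linarith [ht.1]
  have hderiv : ∀ t ∈ Set.uIcc y x, HasDerivAt Real.log (t⁻¹) t := fun t ht =>
    Real.hasDerivAt_log (hmem t ht).ne'
  have hcont : ContinuousOn (fun t : ℝ => t⁻¹) (Set.uIcc y x) :=
    continuousOn_inv₀.mono fun t ht => (hmem t ht).ne'
  have himg : ∀ u ∈ Real.log '' Set.uIcc y x, 0 < u := by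
    rintro u ⟨t, ht, rfl⟩
    rw [Set.uIcc_of_le hyx] at ht
    exact Real.log_pos (by linarith [ht.1])
  have hg : ContinuousOn (fun u : ℝ => Real.exp (θ * u) / u) (Real.log '' Set.uIcc y x) := by
    refine ContinuousOn.div (Continuous.continuousOn (by continuity)) continuousOn_id fun u hu => ?_
    exact (himg u hu).ne'
  have h := intervalIntegral.integral_comp_mul_deriv' hderiv hcont hg
  rw [← h]
  refine intervalIntegral.integral_congr fun t ht => ?_
  have ht0 : 0 < t := hmem t ht
  simp only [Function.comp_apply]
  rw [Real.rpow_def_of_pos ht0, mul_comm (Real.log t) θ]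
  field_simp

/-- Scaling `u = L s`: `∫_a^b e^{(α/L)u} du/u = ∫_{a/L}^{b/L} e^{αs} ds/s` (`L ≠ 0`). [folklore] -/
theorem integral_exp_div_comp_div {a b L : ℝ} (hL : L ≠ 0) (α : ℝ) :
    ∫ u in a..b, Real.exp (α / L * u) / u = ∫ s in a / L..b / L, Real.exp (α * s) / s := by
  have h := intervalIntegral.integral_comp_div (fun s : ℝ => Real.exp (α * s) / s) hL (a := a) (b := b)
  -- `h : ∫ u in a..b, f (u / L) = L • ∫ s in a/L..b/L, f s`
  have e : ∀ u : ℝ, Real.exp (α / L * u) / u = L⁻¹ * (Real.exp (α * (u / L)) / (u / L)) := by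
    intro u
    rcases eq_or_ne u 0 with rfl | hu
    · simp
    · rw [show α / L * u = α * (u / L) by field_simp]
      field_simp
  simp_rw [e, intervalIntegral.integral_const_mul, h, smul_eq_mul]
  field_simp


end Irving2015
end Literature.NumberTheory.Sieve
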